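import Literature.MathematicalPhysics.QuantumFieldTheory.Balaban1983to89.B6Cor28KLevelV1
import HarnessLib

/-!
# `Balaban1983to89.B6Prop27PrintedKernelKLevelV1` — T. Bałaban, *Propagators and renormalization transformations for lattice gauge theories. II*,
Comm. Math. Phys. **96** (1984) 223–250 [Balaban1984PropagatorsII], **Proposition 2.7 (2.149) p. 249 IN PRINT'S KERNEL NORMALISATION, AT k LEVELS,
for the genuine `(QGQ*)⁻¹` of ROUTE V's V1 torus, MODULO THE LEVEL-WEIGHTED (2.147)** (B6-CLOSURE §5 item 19, first half; owner r03): the flat-basis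
entries `⟪e_b, EE e_{b′}⟫` of W3's `B6Prop27KLevelV1.prop27_kLevel` read through print's pairings — the fine pairing `η^d Σ_x` of (2.11)/(2.13) and the
`𝔅`-pairing (2.69) `Σ_j Σ_{b∈Λ_j}(L^jη)^d` (p. 248: the operators `QGQ*`, `(QGQ*)⁻¹` are considered «on the L²-space defined by (2.69) with sites replaced
by bonds») — satisfy the PRINTED shape `|(QGQ*)⁻¹(b, b′)| ≤ O(1)(L^jη)^{−2}(L^{j′}η)^{−d}e^{−½δ₄d(b,b′)}` with `η = |c_f|⁻¹`.

HONEST FRAMING (programme rule): statement-level skeleton of published theorems with citation tags; proofs where landed; nothing here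
is a claim about the Yang–Mills mass gap.

WHAT IS PRINTED (p. 249, = the docstring of the census `B6.Prop27Printed`): «Proposition 2.7. The operator (QGQ*)⁻¹ is given by the convergent
expansions of the form (2.86), and it satisfies the bound |(QGQ*)⁻¹(b, b′)| ≤ O(1)(L^jη)^{−2}(L^{j′}η)^{−d}e^{−½δ₄d(b,b′)}, b ∈ Λ_j, b′ ∈ Λ_{j′}. (2.149)»;
p. 235 (2.69) «⟨λ,λ′⟩ = Σ_{j=0}^{k} Σ_{y∈Λ_j}(L^jη)^d λ(y)λ′(y)»; p. 248 «Finally let us consider the operator QGQ* and its inverse. We consider these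
operators on the L²-space defined by (2.69) with sites replaced by bonds.»

THE DICTIONARY (why this is print's kernel).  The tree's `Δ_a = ∂*∂ + ∂R∂* + Q*aQ` (`B6SectAVectorModelV1.deltaAE c w`, FLAT adjoints, plain block
averages `Q`) is print's (2.19) as a MAP once `c` is print's derivative factor and the tree weight absorbs the pairing ratio, `w_j = a_j·L^{jD}`
(print's form (2.14) `Σ_j Σ_y a_j(L^jη)^d|(Q_jλ)(y)|²` divided by the fine weight `η^d`; this is the factor `(L^D)^{lvl}` of `B6CubeWindowV1.GlobalBand`).
Hence `G = GE` as maps, print's adjoint is `Q*_print = W_fine⁻¹QᵀW_𝔅 = Qᵀ·diag(L^{j(b)D})`, so `(QGQ*_print)⁻¹ = diag(L^{−j(b)D})·EE`, and the kernel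
of an operator `X` on `L²(𝔅)` in the sense of (2.150) (`(XB)(b) = Σ_c (L^{j(c)}η)^d X(b,c)B(c)`) is its matrix entry divided by the weight of the input
bond: **`(QGQ*)⁻¹(b, b′) = L^{−j(b)D}·(L^{j(b′)}η)^{−D}·⟪e_b, EE e_{b′}⟫`** (`D = d + 1` the tree's dimension = print's `d`; `η = |c_f|⁻¹`; `EE` depends
on `c_f²` only).  W3 gives `|⟪e_b, EE e_{b′}⟫| ≤ Λ_b⁻¹Λ_{b′}⁻¹·(2/γ)·e^{−δ₄d_T(βb, βb′)}` with `Λ_b² = (L^{j(b)}η)²·L^{−j(b)D}`; the identity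
`L^{−jD}Λ_b⁻¹ = Λ_b/(L^jη)²` (`B6Cor28KLevelV1.volInv_mul_lamInv_eq`) and the level absorption `Λ_b ≤ L^{D+2}e^{(δ₄/2)d_T}Λ_{b′}` for `M` large
(`B6Cor28KLevelV1.lam_le_absorb`, (2.60)) turn this into the printed shape with rate EXACTLY `½δ₄` and `O(1) = (2/γ)·L^{D+2}`
(print p. 235: «the choice of powers … is purely conventional and we may change it into any other admissible choice … using the exponential factor»).

## WHAT THIS FILE CERTIFIES (kernel-checked, sorry-free, standard axioms; THEOREMS ONLY)

* `kernelFactor_le`: `L^{−j(b)D}·Λ_b⁻¹Λ_{b′}⁻¹ ≤ L^{D+2}·e^{(δ/2)d_T(βb,βb′)}·((L^{j(b)}/c_f)²)⁻¹` under the absorption threshold;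
* **`prop27_kLevel_printedKernel_of_2147`**: binders of `B6Prop27KLevelV1.prop27_kLevel` VERBATIM (its one displayed hypothesis, the level-weighted
  (2.147) with a free `γ > 0`; thresholds `M₂`, `N₁` enlarged): for every `σ ∈ (0, σ₁]`, `α ∈ (0, 1)`, `γ > 0` there are `δ₄ > 0`, `C > 0`, `M₂ > 0`, `N₁`
  with, for every such torus family and ALL index bonds `b, b′`,
  `|L^{−j(b)D}·(L^{j(b′)}/|c_f|)^{−D}·⟪e_b, EE e_{b′}⟫| ≤ C·((L^{j(b)}/|c_f|)²)⁻¹·((L^{j(b′)}/|c_f|)^D)⁻¹·e^{−(δ₄/2)·d_T(βb, βb′)}` — (2.149) as printed,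
  `d(b,b′)` := p21's torus distance (2.46) between the carrier blocks.

## HONEST SCOPE

(1) MODULO (2.147) (a binder; discharged by ROUTE W part W1 `B6QGQCoerciveKLevelV1.qgq_coercive_kLevel` with `γ := γ₀(d, L, b₁)`, after which the
constants depend on `d, L, b₀, b₁, σ, α` only — the hypothesis-free corollary and the census wrapper `B6.Prop27Printed (d+1)` on this family are the
sequel, item 19 second half).  (2) The expansion (2.86) is NOT re-derived (the bound only, as W3).  (3) `η = |c_f|⁻¹` and the dictionary above are
OUR reading of print's pairings (2.11)/(2.14)/(2.69) against the tree's flat model; `δ₄` ours (print: depending on `d, L`).  (4) Setting of W3 (V1 torus,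
`k ≥ 2`, `M_h = L^a ≥ 8`, `R ≥ 2L²`, `P′ ≥ 5`, odd `L ≥ 5`, `Placed`, band (2.16), `M₂ ≤ L·M_h`, `N₁ + 1 ≤ R·L·M_h`).  NOT summit progress.
Unit `lit-balaban-r03` (gen 24), 2026-08-23.
-/

namespace Literature.MathematicalPhysics.QuantumFieldTheory.Balaban1983to89.B6Prop27PrintedKernelKLevelV1

open scoped InnerProductSpace
open LatticeFieldCalculus
open B6SectAOperatorsV1 (QE QsE BondIdx BondIdxSpace)
open B6SectAVectorModelV1 (GE EE)
open B6RandomWalk (delta3)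
open B6MultiLevelBoxOperator (N0)
open B6MultiLevelTorusOperator (TDomains)
open B6GlobalChartV1 (PV domT)
open B6Geom246MultiLevelBox (bset)
open B6Geom246MultiLevelTorus (geomT)
open B6Prop26KLevelSkeletonV1 (pref pref_nonneg)
open B6Prop26KLevelAssemblyV1 (distT_nonneg)
open B6Ineq2142KLevelV1 (lvl β beta_level)
open B6Prop27KLevelV1 (wt lam lam_pos)
open B6Cor28KLevelV1 (volInv_mul_lamInv_eq lam_le_absorb pref_pos two_le_RMh absorb_threshold)
open B6CubeWindowV1 (Placed GlobalBand)
open B6Cover236MultiLevelBlocks (cubes)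

noncomputable section

variable {d ℓ m K : ℕ} {hd : 1 ≤ d + 1} {hL : Odd (ℓ + 1) ∧ 1 < ℓ + 1}
variable {Mh k R : ℕ} {P' : Fin (d + 1) → ℕ}

/-! ## §1  The kernel factor -/

section Factor

variable (hN : ∀ μ, N0 ℓ Mh k P' μ = (PV d ℓ m K hd hL).sitesPerDir 0) (D : TDomains d ℓ Mh k P' R) (hk : k ≤ m + K)

/-- **THE KERNEL FACTOR**: `L^{−j(b)D}·Λ_b⁻¹·Λ_{b′}⁻¹ ≤ L^{D+2}·e^{(δ/2)d_T(βb, βb′)}·((L^{j(b)}/c_f)²)⁻¹` once `L^{D+2}e^{−(δ/2)(R·L·M_h − 1)} ≤ 1`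
(`L^{−jD}Λ_b⁻¹ = Λ_b/(L^jη)²` and the level absorption of `Λ_b/Λ_{b′}`). [cite: Balaban1984PropagatorsII, (2.149) p.249, (2.81) p.237, (2.60) p.234, bookkeeping] -/
theorem kernelFactor_le (hk1 : 1 ≤ k) (hMh : 1 ≤ Mh) (hP : ∀ μ, 1 ≤ P' μ) (hRM : 1 ≤ R * ((ℓ + 1) * Mh)) {cf : ℝ} (hcf : cf ≠ 0)
    {δ : ℝ} (hδ : 0 ≤ δ)
    (hsmall : ((ℓ : ℝ) + 1) ^ (d + 3) * Real.exp (-(δ / 2 * ((R : ℝ) * (((ℓ : ℝ) + 1) * Mh) - 1))) ≤ 1)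
    (b b' : BondIdx (domT hN D hk)) :
    ((((ℓ + 1 : ℕ) : ℝ) ^ (d + 1)) ^ (lvl hN D hk b))⁻¹ * (lam hN D hk cf b)⁻¹ * (lam hN D hk cf b')⁻¹ ≤
      ((ℓ : ℝ) + 1) ^ (d + 3) * Real.exp (δ / 2 * (geomT D).dist (β hN D hk b) (β hN D hk b')) * (pref cf (β hN D hk b))⁻¹ := by
  rw [volInv_mul_lamInv_eq hN D hk hk1 hcf b]
  have hpref := pref_pos D hcf (β hN D hk b)
  have hlb' := lam_pos hN D hk hcf b'
  have habs := lam_le_absorb hN D hk hk1 hMh hP hRM hcf hδ hsmall b b'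
  rw [div_eq_mul_inv, mul_assoc, mul_comm (pref cf (β hN D hk b))⁻¹, ← mul_assoc]
  refine mul_le_mul_of_nonneg_right ?_ (inv_nonneg.2 hpref.le)
  rw [← div_eq_mul_inv, div_le_iff₀ hlb']
  exact habs

end Factor

/-! ## §2  Proposition 2.7 (2.149) in print's kernel normalisation, modulo the level-weighted (2.147) -/

section Main

/-- **[B6] PROPOSITION 2.7 (2.149) IN PRINT'S KERNEL NORMALISATION, AT k LEVELS, MODULO THE LEVEL-WEIGHTED (2.147)**: binders of
`B6Prop27KLevelV1.prop27_kLevel` verbatim (`γ > 0` free; `M₂`, `N₁` enlarged); for ALL index bonds `b ∈ Λ_j`, `b′ ∈ Λ_{j′}` the (2.69)/(2.150)-kernel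
`(QGQ*)⁻¹(b,b′) = L^{−jD}(L^{j′}η)^{−D}⟪e_b, (QGQ*)⁻¹e_{b′}⟫` obeys `|(QGQ*)⁻¹(b,b′)| ≤ C·(L^jη)^{−2}·(L^{j′}η)^{−D}·e^{−½δ₄·d_T(βb,βb′)}`, `η = |c_f|⁻¹`,
`C = (2/γ)·L^{D+2}`, `δ₄ = min(δ₃/4, (γ/A′)/(16D·c/δ₃ + 1))`, `δ₃ = delta3 α (2σ)`.
[cite: Balaban1984PropagatorsII, Prop. 2.7 (2.149) p.249, (2.69) p.235, (2.147) p.248, (2.150) p.249, (2.60) p.234] -/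
theorem prop27_kLevel_printedKernel_of_2147 (d ℓ : ℕ) (hd : 1 ≤ d + 1) (hL : Odd (ℓ + 1) ∧ 1 < ℓ + 1) {b₀ b₁ : ℝ} (hb₀ : 0 < b₀) (hb₁ : b₀ ≤ b₁) :
    ∃ σ₁ : ℝ, 0 < σ₁ ∧ ∀ (σ : ℝ), 0 < σ → σ ≤ σ₁ → ∀ (α : ℝ), 0 < α → α < 1 → ∀ (γ : ℝ), 0 < γ →
    ∃ (δ₄ C M₂ : ℝ) (N₁ : ℕ), 0 < δ₄ ∧ 0 < C ∧ 0 < M₂ ∧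
    ∀ (m K : ℕ) {Mh k R : ℕ} {P' : Fin (d + 1) → ℕ}
      (hN : ∀ μ, N0 ℓ Mh k P' μ = (PV d ℓ m K hd hL).sitesPerDir 0) (D : TDomains d ℓ Mh k P' R) (hk : k ≤ m + K) (_ : 2 ≤ k)
      {a : ℕ} (_ : Mh = (ℓ + 1) ^ a) (_ : 8 ≤ Mh) (_ : 2 * (ℓ + 1) ^ 2 ≤ R) (_ : ∀ μ, 5 ≤ P' μ) (_ : 4 ≤ ℓ)
      (_ : ∀ c : ↥(cubes D.toDomains), Placed ℓ k P' c.1) (_ : M₂ ≤ ((ℓ : ℝ) + 1) * Mh) (_ : N₁ + 1 ≤ R * ((ℓ + 1) * Mh))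
      {cf : ℝ} (hcf : cf ≠ 0) {w : BondIdx (domT hN D hk) → ℝ} (hw : ∀ i, 0 < w i) (_ : GlobalBand b₀ b₁ cf w)
      (_ : ∀ v : BondIdxSpace (domT hN D hk), γ * ∑ i, wt hN D hk cf i * v i ^ 2 ≤
        ⟪QsE (domT hN D hk) v, GE (domT hN D hk) hcf hw (QsE (domT hN D hk) v)⟫_ℝ),
      ∀ b b' : BondIdx (domT hN D hk),
        |((((ℓ + 1 : ℕ) : ℝ) ^ (d + 1)) ^ (lvl hN D hk b))⁻¹ * (((((ℓ + 1 : ℕ) : ℝ)) ^ (lvl hN D hk b') / |cf|) ^ (d + 1))⁻¹ *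
            ⟪EuclideanSpace.single b (1 : ℝ), EE (domT hN D hk) hcf hw (EuclideanSpace.single b' (1 : ℝ))⟫_ℝ| ≤
          C * (((((ℓ + 1 : ℕ) : ℝ)) ^ (lvl hN D hk b) / |cf|) ^ 2)⁻¹ * (((((ℓ + 1 : ℕ) : ℝ)) ^ (lvl hN D hk b') / |cf|) ^ (d + 1))⁻¹ *
            Real.exp (-(δ₄ / 2 * (geomT D).dist (β hN D hk b) (β hN D hk b'))) := by
  obtain ⟨σ₁, hσ₁, h27⟩ := B6Prop27KLevelV1.prop27_kLevel d ℓ hd hL hb₀ hb₁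
  refine ⟨σ₁, hσ₁, fun σ hσ hσ1 α hα hα1 γ hγ0 => ?_⟩
  obtain ⟨A', M₂, c, N₁, hA', hM₂, hc, hEE⟩ := h27 σ hσ hσ1 α hα hα1
  clear h27
  -- the rate
  set δ₃ : ℝ := delta3 α (2 * σ) with hδ₃
  have hδ₃pos : 0 < δ₃ := B6RandomWalk.delta3_pos hα1 (by linarith)
  set δ₄ : ℝ := min (δ₃ / 4) (γ / A' / (2 * (1 * (4 / δ₃) * (2 * ((d : ℝ) + 1) * c)) + 1)) with hδ₄
  have hδ₄pos : 0 < δ₄ := by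
    rw [hδ₄]
    refine lt_min (by linarith) (div_pos (div_pos hγ0 hA') ?_)
    have : 0 ≤ 2 * (1 * (4 / δ₃) * (2 * ((d : ℝ) + 1) * c)) := by positivity
    linarith
  -- the absorption threshold `N₃ ≥ 2(d+3)L/δ₄`
  obtain ⟨N₃, hN₃⟩ : ∃ N₃ : ℕ, N₃ = ⌈2 * ((d : ℝ) + 3) * ((ℓ : ℝ) + 1) / δ₄⌉₊ + 1 := ⟨_, rfl⟩
  have hN₃ge : 2 * ((d : ℝ) + 3) * ((ℓ : ℝ) + 1) ≤ δ₄ * (N₃ : ℝ) := by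
    have h1 : 2 * ((d : ℝ) + 3) * ((ℓ : ℝ) + 1) / δ₄ ≤ (N₃ : ℝ) := by
      rw [hN₃]; push_cast; exact (Nat.le_ceil _).trans (by linarith)
    rw [div_le_iff₀ hδ₄pos] at h1; linarith
  set C : ℝ := 2 / γ * ((ℓ : ℝ) + 1) ^ (d + 3) with hC
  have hC0 : 0 < C := by positivity
  refine ⟨δ₄, C, M₂, max N₁ N₃, hδ₄pos, hC0, hM₂, ?_⟩
  intro m K Mh k R P' hN D hk hk2 a hMha hM8 hR2 hP5 hℓ hpl hM hRM cf hcf w hw hwb hγ b b'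
  have hk1 : 1 ≤ k := le_trans one_le_two hk2
  have hMh : 1 ≤ Mh := le_trans (by norm_num) hM8
  have hP : ∀ μ, 1 ≤ P' μ := fun μ => le_trans (by norm_num) (hP5 μ)
  have hRM1 : 1 ≤ R * ((ℓ + 1) * Mh) := le_trans (Nat.succ_le_succ (Nat.zero_le _)) hRM
  -- (2.149) in the flat basis (W3)
  have h2149 := hEE m K hN D hk hk2 hMha hM8 hR2 hP5 hℓ hpl hM (le_trans (Nat.succ_le_succ (le_max_left _ _)) hRM) hcf hw hwb hγ0 hγ b b'
  clear hEE
  -- the absorption threshold met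
  have hN₃le : (N₃ : ℝ) ≤ (R : ℝ) * (((ℓ : ℝ) + 1) * Mh) - 1 := by
    have h1 : N₃ + 1 ≤ R * ((ℓ + 1) * Mh) := le_trans (Nat.succ_le_succ (le_max_right _ _)) hRM
    have h2 : ((N₃ + 1 : ℕ) : ℝ) ≤ ((R * ((ℓ + 1) * Mh) : ℕ) : ℝ) := by exact_mod_cast h1
    push_cast at h2; linarith
  have hsmall : ((ℓ : ℝ) + 1) ^ (d + 3) * Real.exp (-(δ₄ / 2 * ((R : ℝ) * (((ℓ : ℝ) + 1) * Mh) - 1))) ≤ 1 :=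
    absorb_threshold hδ₄pos hN₃ge hN₃le
  have hfac := kernelFactor_le hN D hk hk1 hMh hP hRM1 hcf hδ₄pos.le hsmall b b'
  -- the common input factor `((L^{j′}/|c_f|)^D)⁻¹ ≥ 0` and the output prefactor
  have hL0 : (0 : ℝ) < ((ℓ + 1 : ℕ) : ℝ) := by positivity
  have hin : 0 ≤ (((((ℓ + 1 : ℕ) : ℝ)) ^ (lvl hN D hk b') / |cf|) ^ (d + 1))⁻¹ := by positivity
  have hV : 0 < ((((ℓ + 1 : ℕ) : ℝ) ^ (d + 1)) ^ (lvl hN D hk b))⁻¹ := by positivity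
  have hpref_eq : (((((ℓ + 1 : ℕ) : ℝ)) ^ (lvl hN D hk b) / |cf|) ^ 2)⁻¹ = (pref cf (β hN D hk b))⁻¹ := by
    unfold pref; rw [beta_level hN D hk hk1, div_pow, div_pow, sq_abs]
  rw [hpref_eq, abs_mul, abs_mul, abs_of_pos hV, abs_of_nonneg hin]
  -- assemble
  have hlb := lam_pos hN D hk hcf b
  have hlb' := lam_pos hN D hk hcf b'
  set V : ℝ := ((((ℓ + 1 : ℕ) : ℝ) ^ (d + 1)) ^ (lvl hN D hk b))⁻¹ with hVdef
  set I : ℝ := (((((ℓ + 1 : ℕ) : ℝ)) ^ (lvl hN D hk b') / |cf|) ^ (d + 1))⁻¹ with hIdef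
  set E : ℝ := |⟪EuclideanSpace.single b (1 : ℝ), EE (domT hN D hk) hcf hw (EuclideanSpace.single b' (1 : ℝ))⟫_ℝ| with hEdef
  set dd : ℝ := (geomT D).dist (β hN D hk b) (β hN D hk b') with hdd
  have hE : E ≤ (lam hN D hk cf b)⁻¹ * (lam hN D hk cf b')⁻¹ * (2 / γ * Real.exp (-(δ₄ * dd))) := h2149
  calc V * I * E ≤ V * I * ((lam hN D hk cf b)⁻¹ * (lam hN D hk cf b')⁻¹ * (2 / γ * Real.exp (-(δ₄ * dd)))) :=
        mul_le_mul_of_nonneg_left hE (mul_nonneg hV.le hin)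
    _ = (V * (lam hN D hk cf b)⁻¹ * (lam hN D hk cf b')⁻¹) * I * (2 / γ) * Real.exp (-(δ₄ * dd)) := by ring
    _ ≤ (((ℓ : ℝ) + 1) ^ (d + 3) * Real.exp (δ₄ / 2 * dd) * (pref cf (β hN D hk b))⁻¹) * I * (2 / γ) * Real.exp (-(δ₄ * dd)) := by
        have h0 : 0 ≤ I * (2 / γ) * Real.exp (-(δ₄ * dd)) := by positivity
        have := mul_le_mul_of_nonneg_right hfac h0
        calc (V * (lam hN D hk cf b)⁻¹ * (lam hN D hk cf b')⁻¹) * I * (2 / γ) * Real.exp (-(δ₄ * dd))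
            = (V * (lam hN D hk cf b)⁻¹ * (lam hN D hk cf b')⁻¹) * (I * (2 / γ) * Real.exp (-(δ₄ * dd))) := by ring
          _ ≤ (((ℓ : ℝ) + 1) ^ (d + 3) * Real.exp (δ₄ / 2 * dd) * (pref cf (β hN D hk b))⁻¹) * (I * (2 / γ) * Real.exp (-(δ₄ * dd))) := this
          _ = _ := by ring
    _ = C * (pref cf (β hN D hk b))⁻¹ * I * Real.exp (-(δ₄ / 2 * dd)) := by
        have hexp : Real.exp (δ₄ / 2 * dd) * Real.exp (-(δ₄ * dd)) = Real.exp (-(δ₄ / 2 * dd)) := by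
          rw [← Real.exp_add]; congr 1; ring
        rw [hC]
        calc ((ℓ : ℝ) + 1) ^ (d + 3) * Real.exp (δ₄ / 2 * dd) * (pref cf (β hN D hk b))⁻¹ * I * (2 / γ) * Real.exp (-(δ₄ * dd))
            = 2 / γ * ((ℓ : ℝ) + 1) ^ (d + 3) * (pref cf (β hN D hk b))⁻¹ * I * (Real.exp (δ₄ / 2 * dd) * Real.exp (-(δ₄ * dd))) := by ring
          _ = _ := by rw [hexp]

end Main

end

end Literature.MathematicalPhysics.QuantumFieldTheory.Balaban1983to89.B6Prop27PrintedKernelKLevelV1
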